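import Mathlib
import Summits.ValiantsHypothesis.ValiantsHypothesis.Theorems.ProofCarryingSymmetryRestorationQPACLayout

/-!
# Route ProofCarryingSymmetry — crux `RestorationQP`, line `registered`: the layout unfolds to the binarised formulas

B-core″, part 3c.  Semantics of the straight-line layout `layoutBody D f P` of a labelled circuit
(part 3b): for an injective numbering `f` increasing along wires and bounded by `P`, the node at
index `i` unfolds (`PICircuit.unfoldList`) to the intended formula `valAt D f i`
(`getD_unfoldList_layoutBody`, strong induction on `i`: a comb node combines the previous comb
node of its block with the output node of the next child, both earlier); hence the output node of
the block of `g` unfolds to `binTree D g` (`getD_unfoldList_layoutBody_outPos`).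

Everything proved; no named facts.
-/

-- single-problem summit: `Summit.ValiantsHypothesis.ValiantsHypothesis.…` is the namespace by design (D-0017)
set_option linter.dupNamespace false

noncomputable section

open scoped Classical

namespace Summit.ValiantsHypothesis.ValiantsHypothesis.Theorems

namespace ACStability

open Literature.Computability.AlgebraicComplexity PICircuit

universe u v

variable {𝔽 : Type u} [Zero 𝔽] [One 𝔽] {X : Type v}

/-! ### Values of an unfolding list, node by node -/

omit [One 𝔽] in
/-- The unfolding at index `i` is the unfolding of node `i` over the earlier unfoldings. [folklore] -/
theorem getD_unfoldList_eq (body : List (Node 𝔽 X)) (i : ℕ) :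
    (unfoldList [] body).getD i (.const 0) = (body.getD i (.const 0)).unfold (unfoldList [] (body.take i)) :=
  getD_unfoldList_eq_unfold_prefixAt body (.const 0) i

omit [One 𝔽] in
/-- Earlier unfoldings are those of the prefix. [folklore] -/
theorem getD_unfoldList_take (body : List (Node 𝔽 X)) {a i : ℕ} (ha : a < i) (hi : i ≤ body.length) :
    (unfoldList [] (body.take i)).getD a (.const 0) = (unfoldList [] body).getD a (.const 0) := by
  have hlen : a < (unfoldList [] (body.take i)).length := by
    simp only [length_unfoldList, List.length_nil, List.length_take, zero_add]; omega
  conv_rhs => rw [← List.take_append_drop i body, unfoldList_append, getD_unfoldList_of_lt _ _ hlen]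

omit [One 𝔽] in
/-- Unfolding of a `+` node with earlier children. [folklore] -/
theorem getD_unfoldList_of_add {body : List (Node 𝔽 X)} {i a b : ℕ} (hn : body.getD i (.const 0) = .add a b)
    (ha : a < i) (hb : b < i) (hi : i ≤ body.length) :
    (unfoldList [] body).getD i (.const 0) =
      .add ((unfoldList [] body).getD a (.const 0)) ((unfoldList [] body).getD b (.const 0)) := by
  rw [getD_unfoldList_eq, hn, Node.unfold, getD_unfoldList_take body ha hi, getD_unfoldList_take body hb hi]

omit [One 𝔽] in
/-- Unfolding of a `×` node with earlier children. [folklore] -/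
theorem getD_unfoldList_of_mul {body : List (Node 𝔽 X)} {i a b : ℕ} (hn : body.getD i (.const 0) = .mul a b)
    (ha : a < i) (hb : b < i) (hi : i ≤ body.length) :
    (unfoldList [] body).getD i (.const 0) =
      .mul ((unfoldList [] body).getD a (.const 0)) ((unfoldList [] body).getD b (.const 0)) := by
  rw [getD_unfoldList_eq, hn, Node.unfold, getD_unfoldList_take body ha hi, getD_unfoldList_take body hb hi]

omit [One 𝔽] in
/-- Unfolding of a variable leaf. [folklore] -/
theorem getD_unfoldList_of_var {body : List (Node 𝔽 X)} {i : ℕ} {x : X} (hn : body.getD i (.const 0) = .var x) :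
    (unfoldList [] body).getD i (.const 0) = .var x := by
  rw [getD_unfoldList_eq, hn, Node.unfold]

omit [One 𝔽] in
/-- Unfolding of a constant leaf. [folklore] -/
theorem getD_unfoldList_of_const {body : List (Node 𝔽 X)} {i : ℕ} {c : 𝔽} (hn : body.getD i (.const 0) = .const c) :
    (unfoldList [] body).getD i (.const 0) = .const c := by
  rw [getD_unfoldList_eq, hn, Node.unfold]

/-! ### The layout unfolds as intended -/

variable {Yo : Type*} {G : Type*} [Fintype G] {D : LabelledArithCircuit 𝔽 X Yo G} {f : G → ℕ}

omit [Zero 𝔽] [One 𝔽] in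
/-- Output nodes of children come before the block of the parent. [folklore] -/
theorem outPos_lt_of_lt {g h : G} (hlt : f h < f g) : outPos f h < f g * bl (G := G) := by
  have hb := two_le_bl (G := G)
  unfold outPos
  calc f h * bl (G := G) + (bl (G := G) - 1) < (f h + 1) * bl (G := G) := by rw [Nat.add_mul, one_mul]; omega
    _ ≤ f g * bl (G := G) := Nat.mul_le_mul_right _ hlt

omit [Zero 𝔽] [One 𝔽] in
/-- The `k`-th child position. [folklore] -/
theorem getD_kidPos (g : G) {k : ℕ} (hk : k < (D.children g).toList.length) :
    (kidPos D f g).getD k 0 = outPos f ((D.children g).toList[k]) := by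
  rw [kidPos, List.getD_eq_getElem _ _ (by simpa using hk), List.getElem_map]

omit [Fintype G] in
/-- The `k`-th child formula. [folklore] -/
theorem getD_kidTrees (g : G) {k : ℕ} (hk : k < (D.children g).toList.length) :
    (kidTrees D g).getD k (.const 0) = binTree D ((D.children g).toList[k]) := by
  rw [kidTrees, List.getD_eq_getElem _ _ (by simpa using hk), List.getElem_map]

/-- Nodes of the layout. [folklore] -/
theorem getD_layoutBody {P i : ℕ} (hi : i < P * bl (G := G)) :
    (layoutBody D f P).getD i (.const 0) = nodeAt D f i := by
  rw [layoutBody, List.getD_eq_getElem _ _ (by simpa using hi), List.getElem_ofFn]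

/-- **The comb case.** Inside the block of an internal gate `g` (node constructor `mk`, formula
operation `op`, unfolding compatibly), if all earlier nodes unfold as intended then so does node
`j`. [folklore] -/
theorem unfold_combNode (hf : Function.Injective f) (hmono : ∀ g h : G, h ∈ D.children g → f h < f g)
    {P : ℕ} (mk : ℕ → ℕ → Node 𝔽 X) (op : PIFormula 𝔽 X → PIFormula 𝔽 X → PIFormula 𝔽 X)
    (hmk : ∀ (body : List (Node 𝔽 X)) (i a b : ℕ), body.getD i (.const 0) = mk a b → a < i → b < i →
      i ≤ body.length → (unfoldList [] body).getD i (.const 0) =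
        op ((unfoldList [] body).getD a (.const 0)) ((unfoldList [] body).getD b (.const 0)))
    (g : G) (hg : ¬ (D.label g).IsInput) {j : ℕ} (hj : j < bl (G := G))
    (hiP : f g * bl (G := G) + j < P * bl (G := G))
    (hnode : (layoutBody D f P).getD (f g * bl (G := G) + j) (.const 0) = combNode D f mk g j)
    (htree : ∀ j', j' < bl (G := G) → blockTree D g j' = combTree D op g j')
    (ih : ∀ i' < f g * bl (G := G) + j, (unfoldList [] (layoutBody D f P)).getD i' (.const 0) = valAt D f i') :
    (unfoldList [] (layoutBody D f P)).getD (f g * bl (G := G) + j) (.const 0) = combTree D op g j := by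
  have hbl : bl (G := G) = Fintype.card G + 2 := rfl
  set r := (D.children g).toList.length with hr
  have hr1 : 1 ≤ r := one_le_length_toList_children hg
  have hrG : r ≤ Fintype.card G := length_toList_children_le g
  have hlenP : (kidPos D f g).length = r := length_kidPos g
  have hlenT : (kidTrees D g).length = r := length_kidTrees g
  have hlen : (layoutBody D f P).length = P * bl (G := G) := by simp [layoutBody]
  -- children facts
  have hkid : ∀ k, k < r → (unfoldList [] (layoutBody D f P)).getD ((kidPos D f g).getD k 0) (.const 0) =
      (kidTrees D g).getD k (.const 0) ∧ (kidPos D f g).getD k 0 < f g * bl (G := G) := by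
    intro k hk
    have hmem : (D.children g).toList[k] ∈ D.children g := Finset.mem_toList.1 (List.getElem_mem hk)
    have hlt : outPos f ((D.children g).toList[k]) < f g * bl (G := G) := outPos_lt_of_lt (hmono g _ hmem)
    rw [getD_kidPos g hk, getD_kidTrees g hk]
    exact ⟨(ih _ (by omega)).trans (valAt_outPos hf _), hlt⟩
  by_cases h1 : r = 1
  · -- one child: `const 1` at `bl - 2`, `t × 1` at `bl - 1`
    have hnode' : (layoutBody D f P).getD (f g * bl (G := G) + j) (.const 0) =
        (if j = bl (G := G) - 1 then Node.mul ((kidPos D f g).getD 0 0) (f g * bl (G := G) + (bl (G := G) - 2))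
          else if j = bl (G := G) - 2 then .const 1 else .const 0) := by
      rw [hnode, combNode, if_pos (hlenP.trans h1)]
    have htree' : combTree D op g j = (if j = bl (G := G) - 1 then combGate op (kidTrees D g)
          else if j = bl (G := G) - 2 then .const 1 else .const 0) := by
      rw [combTree, if_pos (hlenT.trans h1)]
    rw [htree']
    by_cases hj1 : j = bl (G := G) - 1
    · rw [if_pos hj1] at hnode' ⊢
      obtain ⟨hk0, hlt0⟩ := hkid 0 (by omega)
      have hprev : (unfoldList [] (layoutBody D f P)).getD (f g * bl (G := G) + (bl (G := G) - 2)) (.const 0) = .const 1 := by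
        rw [ih _ (by omega), valAt_block hf g (by omega), htree _ (by omega), combTree, if_pos (hlenT.trans h1),
          if_neg (by omega), if_pos rfl]
      rw [getD_unfoldList_of_mul hnode' (by omega) (by omega) (by rw [hlen]; omega), hk0, hprev]
      -- `kidTrees D g = [t]`
      obtain ⟨t, ht⟩ : ∃ t, kidTrees D g = [t] := List.length_eq_one_iff.1 (hlenT.trans h1)
      rw [ht]; rfl
    · rw [if_neg hj1] at hnode' ⊢
      by_cases hj2 : j = bl (G := G) - 2
      · rw [if_pos hj2] at hnode' ⊢; exact getD_unfoldList_of_const hnode'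
      · rw [if_neg hj2] at hnode' ⊢; exact getD_unfoldList_of_const hnode'
  · -- at least two children: the comb
    have h2 : 2 ≤ r := by omega
    have hnode' : (layoutBody D f P).getD (f g * bl (G := G) + j) (.const 0) =
        (if bl (G := G) + 1 ≤ j + r ∧ j + 1 ≤ bl (G := G) then
          (if j + r = bl (G := G) + 1 then mk ((kidPos D f g).getD 0 0) ((kidPos D f g).getD 1 0)
            else mk (f g * bl (G := G) + j - 1) ((kidPos D f g).getD (j + r - bl (G := G)) 0))
          else .const 0) := by
      rw [hnode, combNode, if_neg (by rw [hlenP]; exact h1), hlenP]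
    have htree' : ∀ j', combTree D op g j' = (if bl (G := G) + 1 ≤ j' + r ∧ j' + 1 ≤ bl (G := G) then
          combGate op ((kidTrees D g).take (j' + r - bl (G := G) + 1)) else .const 0) := by
      intro j'; rw [combTree, if_neg (by rw [hlenT]; exact h1), hlenT]
    rw [htree']
    by_cases hrange : bl (G := G) + 1 ≤ j + r ∧ j + 1 ≤ bl (G := G)
    · rw [if_pos hrange] at hnode' ⊢
      by_cases hk1 : j + r = bl (G := G) + 1
      · rw [if_pos hk1] at hnode'
        obtain ⟨hk0, hlt0⟩ := hkid 0 (by omega)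
        obtain ⟨hk1', hlt1⟩ := hkid 1 (by omega)
        rw [hmk _ _ _ _ hnode' (by omega) (by omega) (by rw [hlen]; omega), hk0, hk1',
          show j + r - bl (G := G) + 1 = 2 by omega, combGate_take_two op (by omega)]
      · rw [if_neg hk1] at hnode'
        set k := j + r - bl (G := G) with hk
        have hk2 : 2 ≤ k := by omega
        have hkr : k < r := by omega
        obtain ⟨hkk, hltk⟩ := hkid k hkr
        have hprev : (unfoldList [] (layoutBody D f P)).getD (f g * bl (G := G) + j - 1) (.const 0) =
            combGate op ((kidTrees D g).take k) := by
          rw [show f g * bl (G := G) + j - 1 = f g * bl (G := G) + (j - 1) by omega, ih _ (by omega),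
            valAt_block hf g (by omega), htree _ (by omega), htree', if_pos (by omega)]
          congr 2; omega
        rw [hmk _ _ _ _ hnode' (by omega) (by omega) (by rw [hlen]; omega), hprev, hkk,
          combGate_take_succ op hk2 (by rw [hlenT]; exact hkr)]
    · rw [if_neg hrange] at hnode' ⊢
      exact getD_unfoldList_of_const hnode'

/-- **The layout unfolds as intended.** For an injective numbering increasing along wires and
bounded by `P`, every node of `layoutBody D f P` unfolds to `valAt D f i`. [folklore] -/
theorem getD_unfoldList_layoutBody (hf : Function.Injective f) (hmono : ∀ g h : G, h ∈ D.children g → f h < f g)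
    {P : ℕ} :
    ∀ i, i < P * bl (G := G) → (unfoldList [] (layoutBody D f P)).getD i (.const 0) = valAt D f i := by
  intro i
  induction i using Nat.strong_induction_on with
  | _ i ih =>
    intro hi
    have hb := two_le_bl (G := G)
    have hbpos : 0 < bl (G := G) := by omega
    have hnode := getD_layoutBody (D := D) (f := f) hi
    by_cases hex : ∃ g, f g = i / bl (G := G)
    · obtain ⟨g, hg⟩ := hex
      -- write `i = f g * bl + j`
      set j := i % bl (G := G) with hj
      have hjb : j < bl (G := G) := Nat.mod_lt _ hbpos
      have hi_eq : i = f g * bl (G := G) + j := by rw [hg, hj]; exact (Nat.div_add_mod' i _).symm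
      rw [hi_eq] at hnode hi ⊢
      rw [nodeAt_block hf g hjb] at hnode
      rw [valAt_block hf g hjb]
      have ih' : ∀ i' < f g * bl (G := G) + j, (unfoldList [] (layoutBody D f P)).getD i' (.const 0) = valAt D f i' :=
        fun i' hi' => ih i' (by rw [hi_eq]; exact hi') (by omega)
      unfold blockNode at hnode
      unfold blockTree
      rcases hl : D.label g with x | c | _ | _ <;> simp only [hl] at hnode ⊢
      · by_cases hj1 : j = bl (G := G) - 1
        · rw [if_pos hj1] at hnode ⊢; exact getD_unfoldList_of_var hnode
        · rw [if_neg hj1] at hnode ⊢; exact getD_unfoldList_of_const hnode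
      · by_cases hj1 : j = bl (G := G) - 1
        · rw [if_pos hj1] at hnode ⊢; exact getD_unfoldList_of_const hnode
        · rw [if_neg hj1] at hnode ⊢; exact getD_unfoldList_of_const hnode
      · exact unfold_combNode hf hmono Node.add PIFormula.add (fun body i a b hn ha hb hl => getD_unfoldList_of_add hn ha hb hl)
          g (by simp [hl, CircuitLabel.IsInput]) hjb hi hnode
          (fun j' _ => by unfold blockTree; simp only [hl]) ih'
      · exact unfold_combNode hf hmono Node.mul PIFormula.mul (fun body i a b hn ha hb hl => getD_unfoldList_of_mul hn ha hb hl)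
          g (by simp [hl, CircuitLabel.IsInput]) hjb hi hnode
          (fun j' _ => by unfold blockTree; simp only [hl]) ih'
    · rw [nodeAt, dif_neg hex] at hnode
      rw [valAt, dif_neg hex]
      exact getD_unfoldList_of_const hnode

/-- **The output node of the block of `g` unfolds to `binTree D g`.** [folklore] -/
theorem getD_unfoldList_layoutBody_outPos (hf : Function.Injective f)
    (hmono : ∀ g h : G, h ∈ D.children g → f h < f g) {P : ℕ} (hP : ∀ g, f g < P) (g : G) :
    (unfoldList [] (layoutBody D f P)).getD (outPos f g) (.const 0) = binTree D g := by
  have hb := two_le_bl (G := G)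
  have hlt : outPos f g < P * bl (G := G) := by
    unfold outPos
    calc f g * bl (G := G) + (bl (G := G) - 1) < (f g + 1) * bl (G := G) := by rw [Nat.add_mul, one_mul]; omega
      _ ≤ P * bl (G := G) := Nat.mul_le_mul_right _ (hP g)
  rw [getD_unfoldList_layoutBody hf hmono _ hlt, valAt_outPos hf]

end ACStability

open Literature.Computability.AlgebraicComplexity in
/-- **The layout of a labelled circuit unfolds, at the output node of each gate's block, to the
gate's binarised formula** (registered helper toward the converse of S3″ / honesty of stub S2″
`stub_proofsToACEquiv`, crux `RestorationQP`). [folklore] -/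
theorem proofsToACEquiv_aux_layoutUnfold : ∀ (n : ℕ) (G : Type) [Fintype G] (D : LabelledArithCircuit ℂ (Fin n × Fin n) Unit G) (f : G → ℕ) (P : ℕ), Function.Injective f → (∀ g h : G, h ∈ D.children g → f h < f g) → (∀ g : G, f g < P) → ∀ g : G, (PICircuit.unfoldList [] (ACStability.layoutBody D f P)).getD (ACStability.outPos f g) (PIFormula.const 0) = ACStability.binTree D g := by
  intro n G _ D f P hf hmono hP g
  exact ACStability.getD_unfoldList_layoutBody_outPos hf hmono hP g

end Summit.ValiantsHypothesis.ValiantsHypothesis.Theorems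

end
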